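import Summits.BirchSwinnertonDyer.BirchSwinnertonDyer.Theorems.SchneiderFreeAdditiveX3PoitouTateMuKummerUnramified
import Literature.NumberTheory.GaloisCohomology.PoitouTateOddLevelRealPlaces
import Literature.NumberTheory.GaloisRepresentations.ContinuousH1OrderTwo
import HarnessLib

/-!
# Poitou–Tate toolkit (μₚ-case, 4/·): Milne *ADT* I Thm. 4.10(b) `Ker γ¹ ⊆ Im β¹` for `M = μₚ`
# over ANY number field for odd `p` (and over totally complex ones for `p = 2`)

Seat `bsd-schneider-door-c6`, gen 6 (cell `bsd-schneider-ideate`; crux `AnticycControlAdditiveK`,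
stmt-BirchSwinnertonDyer-19295).  THEOREMS ONLY.  HONEST FRAMING: the `μₚ`-instance (all finite `M` is NOT
claimed) of the hypothesis `hE` of `exists_localInvariants_duality_of_middleExact_canonical` (p484492); no case
of BSD.  File 3/· (`middleExact_mu`) assumed `K` totally complex; the only uses of that hypothesis were at
the archimedean places: (i) the local Tate pairing term at `Sum.inl w` vanishes — at a complex place because
THE invariant map is `0` there (`canonical_inl_eq_zero_of_isComplex`), at a real place for odd `p` because it
is killed by `2` (`canonical_inl_eq_zero_of_odd`); (ii) `H¹(K_w, μₚ) = 0` — at a complex place trivially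
(`galoisCohomology_inl_eq_zero_of_isComplex`), at a real place for odd `p` since the group is killed by `2`
and by `p` (`eq_zero_of_odd_nsmul_galoisCohomology_one_toLocal_inl`).  Hence:

* `middleExact_mu_of_isComplex_or_odd` — Milne I 4.10(b) `Ker γ¹ ⊆ Im β¹` for `ρ = mu K p` under
  `(∀ w, w.IsComplex) ∨ Odd p`, unconditional (same proof as file 2/·, with the Kummer-unit input of file 3/·).

References: [MilneADT2006] I Thm. 4.10(b), I Ex. 1.6 (c); [CasselsFrohlichANT1967] VII §5.1, §11;
[SerreLocalFields1979] XIV §1.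
-/

noncomputable section

open CategoryTheory Function NumberField IsDedekindDomain Field ValuativeRel
open scoped NumberField

set_option linter.dupNamespace false

namespace Summit.BirchSwinnertonDyer.BirchSwinnertonDyer.Theorems.SchneiderFreeAdditiveX3.PoitouTateReduction

open _root_.ContinuousCohomology
open Literature.NumberTheory.GaloisRepresentations
open Literature.NumberTheory.GaloisRepresentations.DiscreteGaloisModule
open Literature.NumberTheory.GaloisRepresentations.IsNonarchimedeanLocalField
open Literature.NumberTheory.GaloisCohomology
open Literature.NumberTheory.NumberFields
open Literature.AnabelianGeometry.AbsoluteAnabelian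
open Literature.AnabelianGeometry.AbsoluteAnabelian.Prop121vii
open Summit.BirchSwinnertonDyer.Rank1Residual.X11b
open Summit.BirchSwinnertonDyer.Rank1Residual.JET.GlobalDuality

variable {K : Type} [Field K] [NumberField K] {p : ℕ} [hp : Fact p.Prime]

/-- **Milne *ADT* I Thm. 4.10(b) `Ker γ¹ ⊆ Im β¹` for `M = μₚ` over ANY number field when `p` is odd, and
over a totally complex one when `p = 2`** (archimedean hypothesis `harch`), UNCONDITIONAL (the Kummer-unit
input is `localization_δ₀_mem_unramifiedSubgroup_of_eq_unit_mul_pow`).  In the shape of the hypothesis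
`hE` of `exists_localInvariants_duality_of_middleExact_canonical` specialised to `ρ = mu K p`: for a
finite set `S` of places containing the infinite ones, with `p ∉ w` for the finite `w ∉ S`, every family
of local classes `t_v ∈ H¹(K_v, μₚ)` which is orthogonal, under the sum over `S` of the local Tate
pairings of THE invariant maps, to every class of `H¹(K, μₚ^D)` unramified outside `S`, is the
localisation on `S` of a global class `x ∈ H¹(K, μₚ)` unramified outside `S`.
[cite: MilneADT2006, Ch. I, Thm. 4.10(b)] [cite: CasselsFrohlichANT1967, Ch. VII §5.1 Main Theorem (B), (D)] -/
theorem middleExact_mu_of_isComplex_or_odd (harch : (∀ w : InfinitePlace K, w.IsComplex) ∨ Odd p)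
    (S : Finset (Place K)) (_hinf : ∀ w : InfinitePlace K, (Sum.inl w : Place K) ∈ S)
    (hS : ∀ v : HeightOneSpectrum (𝓞 K), (Sum.inr v : Place K) ∉ S →
      ((p : ℕ) : 𝓞 K) ∉ v.asIdeal ∧ GaloisRep.IsUnramifiedAt v (mu K p))
    (t : Π v : Place K, galoisCohomology ((mu K p).toLocal v) 1)
    (horth : ∀ y : galoisCohomology ((mu K p).tateDual p) 1,
      (∀ v : HeightOneSpectrum (𝓞 K), (Sum.inr v : Place K) ∉ S →
        galoisCohomology.localization ((mu K p).tateDual p) (Sum.inr v) 1 y ∈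
          unramifiedSubgroup (GaloisRep.toLocal v ((mu K p).tateDual p)) 1) →
      ∑ v ∈ S, localTatePairingZMod (mu K p) p v (LocalInvariants.canonical K p v) (t v)
        (galoisCohomology.localization ((mu K p).tateDual p) v 1 y) = 0) :
    ∃ x : galoisCohomology (mu K p) 1,
      (∀ v : HeightOneSpectrum (𝓞 K), (Sum.inr v : Place K) ∉ S →
        galoisCohomology.localization (mu K p) (Sum.inr v) 1 x ∈
          unramifiedSubgroup (GaloisRep.toLocal v (mu K p)) 1) ∧
      ∀ v ∈ S, galoisCohomology.localization (mu K p) v 1 x = t v := by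
  classical
  haveI : NeZero p := ⟨hp.out.ne_zero⟩
  haveI : CompactSpace (absoluteGaloisGroup K) := absoluteGaloisGroup_compactSpace K
  haveI : Finite (MuCarrier K p) := Literature.NumberTheory.GaloisRepresentations.finite_muCarrier K p
  set hR := artinReciprocity_character_holds
  -- the finite places of `S`
  set Sf : Finset (HeightOneSpectrum (𝓞 K)) := S.toRight with hSf
  have hmemSf : ∀ v, v ∈ Sf ↔ (Sum.inr v : Place K) ∈ S := fun v => by rw [hSf, Finset.mem_toRight]
  -- §1. Kummer half: `t_v = loc_v κ(b)` on the finite part of `S`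
  obtain ⟨b, hb0, -, hbt⟩ := exists_forall_localization_δ₀_eq (n := p) Sf fun v => t (Sum.inr v)
  set bu : Kˣ := Units.mk0 b hb0 with hbu
  have hκb : (isSES_kummer K p (NeZero.pos p)).δ₀ (baseUnitsInvariant K (bu : K) bu.ne_zero) =
      (isSES_kummer K p (NeZero.pos p)).δ₀ (baseUnitsInvariant K b hb0) := rfl
  -- §2. the idèle `ξ = ∏_{v ∈ Sf} ⟨b⟩_v`
  set ξ : ideleGroup K := ∏ v ∈ Sf, localUnits v (globalToLocalUnits v bu) with hξ
  have hξsnd : ∀ v, (ξ : AdeleRing (𝓞 K) K).2 v =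
      if v ∈ Sf then algebraMap K (v.adicCompletion K) b else 1 := by
    intro v
    rw [hξ, snd_prod_localUnits]
    split_ifs <;> simp [val_globalToLocalUnits, hbu]
  -- Weil-group lifts of `b` at the finite places
  have hlift : ∀ v : HeightOneSpectrum (𝓞 K), ∃ w : WeilGroup (v.adicCompletion K),
      canonicalArtin (v.adicCompletion K) w = globalToLocalUnits v bu := fun v =>
    (isLocalArtinMap_canonicalArtin_holds (v.adicCompletion K)).isOpenQuotientMap_artin.surjective _
  choose wv hwv using hlift
  -- §3. class-field half: `ξ` is killed by every faithful character of exponent `p` unramified off `Sf`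
  have hsep := exists_eq_principalIdele_mul_mul_pow_of_forall_faithful_character (n := p) Sf ξ
    fun L _ _ _ χ hinj hχp hunr => ?goal
  case goal =>
    -- local units at `v ∉ Sf` are killed by `ψ_{L|K}` (faithfulness of `χ`)
    have hunits : ∀ v : HeightOneSpectrum (𝓞 K), v ∉ Sf → ∀ u : (v.adicCompletion K)ˣ,
        Valued.v (u : v.adicCompletion K) = 1 → artinIdeleMap L hR (localUnits v u) = 1 :=
      fun v hv u hu => hinj (by rw [map_one]; exact hunr v hv u hu)
    -- the cyclic character of `χ`
    obtain ⟨d, hdne, ζ, ψ, hζ, hker, hval, hdvd⟩ := exists_cyclicCharacter_of_injective L χ hinj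
    have hd : d = 1 ∨ d = p := (Nat.dvd_prime hp.out).mp (hdvd p hχp)
    -- `χ(ψ_{L|K} ξ) = ∏_{v ∈ Sf} χ(r_L(res_v w_v))⁻¹ = (∏ ζ ^ (ψ(res_v w_v)).val)⁻¹`
    have hχξ : χ (artinIdeleMap L hR ξ) =
        (∏ v ∈ Sf, ζ ^ (ψ (absGaloisRestrict K (v.adicCompletion K)
          (WeilGroup.toAbsGalois (v.adicCompletion K) (wv v)))).val)⁻¹ := by
      rw [← MonoidHom.comp_apply, hξ, map_prod, ← Finset.prod_inv_distrib]
      refine Finset.prod_congr rfl fun v _ => ?_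
      rw [MonoidHom.comp_apply, ← hwv v, artinIdeleMap_localUnits_canonicalArtin_eq_inv L (wv v), map_inv,
        hval]
    rcases hd with hd1 | hdp
    · -- `d = 1`: `ψ` is trivial, so every factor is `ζ ^ 0`
      subst hd1
      rw [hχξ, inv_eq_one]
      refine Finset.prod_eq_one fun v _ => ?_
      rw [show (ψ (absGaloisRestrict K (v.adicCompletion K)
        (WeilGroup.toAbsGalois (v.adicCompletion K) (wv v)))).val = 0 from by
          rw [Subsingleton.elim (ψ _) 0, ZMod.val_zero], pow_zero]
    · subst d
      -- the class `y = [ψ]` is unramified outside `S`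
      set y : galoisCohomology ((mu K p).tateDual p) 1 := oneCocycleClass _ (scalarCocycle ψ) with hy
      have hyur : ∀ v : HeightOneSpectrum (𝓞 K), (Sum.inr v : Place K) ∉ S →
          galoisCohomology.localization ((mu K p).tateDual p) (Sum.inr v) 1 y ∈
            unramifiedSubgroup (GaloisRep.toLocal v ((mu K p).tateDual p)) 1 := fun v hv =>
        localization_oneCocycleClass_scalarCocycle_mem_unramifiedSubgroup_of_forall_localUnits
          L ψ hker v (hunits v fun h => hv ((hmemSf v).mp h))
      have hsum := horth y hyur
      -- the archimedean terms vanish (`K` totally complex): the sum is over `Sf`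
      have hsub : Sf.map ⟨Sum.inr, Sum.inr_injective⟩ ⊆ S := fun q hq => by
        obtain ⟨v, hv, rfl⟩ := Finset.mem_map.mp hq
        exact (hmemSf v).mp hv
      rw [← Finset.sum_subset hsub (fun q hq hq' => ?_), Finset.sum_map] at hsum
      swap
      · rcases q with w | v
        · rw [localTatePairingZMod_apply]
          rcases harch with hK | hodd
          · exact LocalInvariants.canonical_inl_eq_zero_of_isComplex (hK w) _
          · exact LocalInvariants.canonical_inl_eq_zero_of_odd hodd w _
        · exact absurd (Finset.mem_map.mpr ⟨v, (hmemSf v).mpr hq, rfl⟩) hq'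
      simp only [Function.Embedding.coeFn_mk] at hsum
      -- each finite term is `-ψ(res_v w_v)` (Serre XIV §1 Prop. 3, this gen's theorem)
      have hterm : ∀ v ∈ Sf, localTatePairingZMod (mu K p) p (Sum.inr v)
          (LocalInvariants.canonical K p (Sum.inr v)) (t (Sum.inr v))
          (galoisCohomology.localization ((mu K p).tateDual p) (Sum.inr v) 1 y) =
          -ψ (absGaloisRestrict K (v.adicCompletion K) (WeilGroup.toAbsGalois (v.adicCompletion K) (wv v))) := by
        intro v hv
        rw [← hbt v hv, ← hκb, localTatePairingZMod_apply, ← LocalInvariants.localization_cupProduct,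
          LocalInvariants.canonical_inr, hy]
        exact localInvariantMap_localization_cupProduct_δ₀_eq_neg_apply L ψ hker bu v (wv v) (hwv v)
      rw [Finset.sum_congr rfl fun v hv => hterm v hv, Finset.sum_neg_distrib, neg_eq_zero] at hsum
      -- hence `∑ (ψ(res_v w_v)).val ≡ 0 (mod p)` and `χ(ψ_{L|K} ξ) = (ζ ^ (p · m))⁻¹ = 1`
      have hdvd' : p ∣ ∑ v ∈ Sf, (ψ (absGaloisRestrict K (v.adicCompletion K)
          (WeilGroup.toAbsGalois (v.adicCompletion K) (wv v)))).val := by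
        rw [← ZMod.natCast_eq_zero_iff, Nat.cast_sum]
        simpa only [ZMod.natCast_zmod_val] using hsum
      rw [hχξ, Finset.prod_pow_eq_pow_sum, (hζ.pow_eq_one_iff_dvd _).mpr hdvd', inv_one]
  -- §4. the global class `x = κ(a₀)`
  obtain ⟨a₀, u, yI, hu, hdec⟩ := hsep
  have hcomp : ∀ v : HeightOneSpectrum (𝓞 K), (ξ : AdeleRing (𝓞 K) K).2 v =
      algebraMap K (v.adicCompletion K) (a₀ : K) * (u : AdeleRing (𝓞 K) K).2 v *
        ((yI : AdeleRing (𝓞 K) K).2 v) ^ p := by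
    intro v
    have h := congrArg (fun z : ideleGroup K => ideleGroup.finComp v z) hdec
    simp only [map_mul, map_pow, ideleGroup.finComp_apply, principalIdele_snd] at h
    exact h
  refine ⟨(isSES_kummer K p hp.out.pos).δ₀ (baseUnitsInvariant K (a₀ : K) a₀.ne_zero), fun v hv => ?_,
    fun q hq => ?_⟩
  · -- unramified outside `S`: `a₀ ∈ 𝒪_vˣ · (K_vˣ)ᵖ` at `v ∉ Sf`
    have hvSf : v ∉ Sf := fun h => hv ((hmemSf v).mp h)
    have h1 := hcomp v
    rw [hξsnd, if_neg hvSf] at h1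
    have hu0 : (u : AdeleRing (𝓞 K) K).2 v ≠ 0 := ideleGroup_snd_ne_zero u v
    have hy0 : (yI : AdeleRing (𝓞 K) K).2 v ≠ 0 := ideleGroup_snd_ne_zero yI v
    refine localization_δ₀_mem_unramifiedSubgroup_of_eq_unit_mul_pow v (a₀ : K) a₀.ne_zero (hS v hv).1
      ⟨(Units.mk0 _ hu0)⁻¹, ((yI : AdeleRing (𝓞 K) K).2 v)⁻¹, ?_, ?_⟩
    · rw [Units.val_inv_eq_inv_val, Units.val_mk0, map_inv₀, hu.2.2 v, inv_one]
    · rw [Units.val_inv_eq_inv_val, Units.val_mk0, inv_pow]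
      have h2 : algebraMap K (v.adicCompletion K) (a₀ : K) *
          ((u : AdeleRing (𝓞 K) K).2 v * ((yI : AdeleRing (𝓞 K) K).2 v) ^ p) = 1 := by
        rw [← mul_assoc]; exact h1.symm
      rw [eq_inv_of_mul_eq_one_left h2, mul_inv]
  · rcases q with w | v
    · -- infinite places: everything vanishes (complex place, or odd `p` at a real place)
      have hzero : ∀ c : galoisCohomology ((mu K p).toLocal (Sum.inl w)) 1, c = 0 := fun c => by
        rcases harch with hK | hodd
        · exact galoisCohomology_inl_eq_zero_of_isComplex (mu K p) (hK w) c
        · refine eq_zero_of_odd_nsmul_galoisCohomology_one_toLocal_inl (mu K p) w hodd c ?_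
          refine galoisCohomology.nsmul_eq_zero_of_forall _ (fun m => ?_) c
          rw [← natCast_zsmul]
          exact zsmul_muCarrier_eq_zero K p m
      rw [hzero (t _)]
      exact hzero _
    · -- finite places of `S`: `b = a₀ · yᵖ` in `K_v`
      have hvSf : v ∈ Sf := (hmemSf v).mpr hq
      have h1 := hcomp v
      rw [hξsnd, if_pos hvSf, hu.2.1 v hvSf, mul_one] at h1
      rw [← hbt v hvSf]
      exact (localization_δ₀_eq_of_eq_mul_pow v (a₀ : K) b a₀.ne_zero hb0 (ideleGroup_snd_ne_zero yI v) h1).symm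

end Summit.BirchSwinnertonDyer.BirchSwinnertonDyer.Theorems.SchneiderFreeAdditiveX3.PoitouTateReduction

end
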